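import Summits.BirchSwinnertonDyer.BirchSwinnertonDyer.Theorems.GenusKolyvaginAtTwoGenusPrimitiveSupplyAtTwoTwistTamagawaOdd
import Summits.BirchSwinnertonDyer.BirchSwinnertonDyer.Theorems.GenusKolyvaginAtTwoGenusPrimitiveSupplyAtTwoLocalTwoTorsion
import Summits.BirchSwinnertonDyer.BirchSwinnertonDyer.Theorems.GenusKolyvaginAtTwoGenusPrimitiveSupplyAtTwoTwistSelmerTransferDownRat
import Summits.BirchSwinnertonDyer.BirchSwinnertonDyer.Theorems.GenusKolyvaginAtTwoEquivariantKolyvaginExactAtTwoArchimedeanVanishingNegDisc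
import Summits.BirchSwinnertonDyer.BirchSwinnertonDyer.Theorems.GenusKolyvaginAtTwoGenusPrimitiveSupplyAtTwoLoweringStep
import Summits.BirchSwinnertonDyer.Rank1Residual.AdditivePotMult.QuadraticTwistTamagawaMultiplicative
import Summits.BirchSwinnertonDyer.Rank1Residual.AdditivePotMult.QuadraticTwistTamagawaGood
import Literature.NumberTheory.EllipticCurves.Castella2018.TamagawaQuadraticBaseChangeProofs
import Literature.NumberTheory.QuadraticFields.DiscriminantOfSqrt
import Literature.NumberTheory.EllipticCurves.NeronComponentIndexSplitProofs
import Literature.NumberTheory.EllipticCurves.NonsplitProofs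
import Literature.NumberTheory.DiophantineGeometry.MinimalDiscriminantBaseChangeCongruence
import Literature.NumberTheory.EllipticCurves.LocalTorsionMultiplicativeProofs
import Literature.NumberTheory.EllipticCurves.TwistFamilySelmerGroupCardInvarianceProofs
import Literature.NumberTheory.EllipticCurves.QuadraticTwistJInvariantProofs
import Literature.NumberTheory.EllipticCurves.GlobalMinimalModelProofs
import Literature.NumberTheory.EllipticCurves.BinaryQuarticStabilizerTorsion
import Literature.NumberTheory.EllipticCurves.LeadingTermBSZOrdinaryProofs
import Literature.NumberTheory.EllipticCurves.LFunctionPrimeCoeff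
import Literature.NumberTheory.EllipticCurves.RootNumberTwistProofs
import Literature.NumberTheory.EllipticCurves.MazurRubin2010.TwistSelmerRankControl
import Literature.NumberTheory.EllipticCurves.IrreducibleModPQuadraticTwistProofs
import Literature.NumberTheory.EllipticCurves.NewformSymmSquareTwistClass
import HarnessLib

/-!
# Route `GenusKolyvaginAtTwo`, crux #2 `GenusPrimitiveSupplyAtTwo` (stmt-BirchSwinnertonDyer-22136):
# the `ℚ`-DICTIONARY from the printed hypotheses of Mazur–Rubin 2010 Prop. 3.3 / Cor. 3.4 (ii) to the place menu of
# `…TwistTamagawaOdd.natCard_selmerGroup_twist_eq_of_menu` (split primes, Tamagawa parity, twists at odd `p ∤ d`, local `2`-torsion)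

Lead seat `bsd-line-gk2-p1` g9 (cell `bsd-f1-sign2`). THEOREMS ONLY (no definition, no named fact, no `sorry`); helper
`--supports stmt-BirchSwinnertonDyer-22136`; consumed by the sibling file `…MazurRubinCor34ii` (discharge of
`MazurRubin2010.cor34ii_rat`). BSD is not proved by any of this.

* §A–§B `natCard_torsionBy_two_quadraticTwist`, `natCard_twoTorsion_padic_twist_eq` — the `2`-torsion of a quadratic twist over
  ANY field of characteristic `≠ 2` has the cardinality of that of the curve (the roots of the `2`-division cubics correspond under
  `x ↦ d x`); hence `#Wd(ℚ_p)[2] = #W(ℚ_p)[2]` for every model `Wd` of `W^{(d)}` (Mazur–Rubin Remark 2.4 / Lemma 2.2 (i) on points).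
* §C `exists_sq_eq_adicCompletion_of_ncard_primesOver_eq_two` — a prime that splits in `ℚ(√d)` (`d` square-free `≠ 1`) has
  `d ∈ (ℚ_v^×)²` (`d_F ∈ {d, 4d}`: `Quadratic.discr_eq_of_sq_eq_intCast` / `…four_mul…`; `d_F` is a `p`-adic square at a split
  prime: `Castella2018.TamagawaQuadratic.isSquare_padic_discr_of_splitsIn`; transport along `ℚ_v ≃ ℚ_p`);
  `pos_of_isTotallyReal_of_sq_eq` — `F` totally real ⟹ `d > 0`.
* §D `not_two_dvd_localTamagawaNumber_of_mult_of_odd` — `c_v` is odd at a multiplicative place with `ord_v Δ_min` odd, any number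
  field (split: `c_v = ord_v Δ_min`; non-split: `c_v = 1`) — why Lemma 2.10 (iii) is a case of Lemma 2.9.
* §E `odd_ordMinimalDiscriminant_iff_odd_padicValRat` — `ord_v Δ_min ≡ ord_p Δ(W) (mod 12)` at the places of `𝓞 ℚ`, any model.
* §F the twist at an odd `p ∤ d`, ANY model `W`: good stays good, multiplicative stays multiplicative (the tree's `AdditivePotMult`
  lemmas on a global minimal model, transported by `quadraticTwist_smul`); `ord_p Δ(W^{(d)}) ≡ ord_p Δ(W) (mod 2)`; and the
  SILENT-row currency bridge `W(ℚ_p)[2] = 0 ⟹ #ker(2 : W(ℚ_v)) = 1`.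

References: [MazurRubin2010] arXiv:0904.3709: Remark 2.4, Lemma 2.2 (i), Lemma 2.9, Lemma 2.10; [SilvermanAEC2009] VII.1 Rem. 1.1,
VII.5 Prop. 5.1, X.5 Cor. 5.4, III.2.3; [SilvermanATAEC1994] IV.9.4, Cor. IV.9.2 (d); [Marcus2018] Ch. 2 Thm. 1; [NeukirchANT1999]
Ch. I (8.5).
-/

set_option linter.dupNamespace false -- tree convention: `Summit.BirchSwinnertonDyer.BirchSwinnertonDyer.Theorems` (summit = sub-problem)
set_option autoImplicit false

noncomputable section

open scoped Classical ContRepresentation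

namespace Summit.BirchSwinnertonDyer.BirchSwinnertonDyer.Theorems.GenusKolyTwistTamagawa

open WeierstrassCurve Field NumberField IsDedekindDomain Function Polynomial
open Literature.NumberTheory.EllipticCurves Literature.NumberTheory.GaloisRepresentations
open Literature.NumberTheory.GaloisCohomology
open Rat.HeightOneSpectrum

/-! ## §A Roots of the `2`-division cubic of a quadratic twist -/

section Roots

variable {F : Type*} [Field F] [NeZero (2 : F)] (V : WeierstrassCurve F)

/-- **The `2`-division cubic of the quadratic twist**: `ψ_{W^{(d)}}(d x) = d³ ψ_W(x)`, so `d x` is a root of the twist's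
`2`-division cubic `4X³ + d b₂X² + 2d²b₄X + d³b₆` iff `x` is a root of `4X³ + b₂X² + 2b₄X + b₆` (any field with `2 ≠ 0`, `d ≠ 0`).
[cite: SilvermanAEC2009, X.5 Cor. 5.4 and III.2.3 (the twist by universal formulas in the bᵢ)] -/
theorem isRoot_twoTorsionPolynomial_quadraticTwist_iff {d : F} (hd : d ≠ 0) (x : F) :
    (V.quadraticTwist d).twoTorsionPolynomial.toPoly.IsRoot (d * x) ↔ V.twoTorsionPolynomial.toPoly.IsRoot x := by
  simp only [twoTorsionPolynomial, Cubic.toPoly, IsRoot.def, eval_add, eval_mul, eval_C, eval_pow, eval_X,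
    quadraticTwist_b₂, quadraticTwist_b₄, quadraticTwist_b₆]
  have hd3 : d ^ 3 ≠ 0 := pow_ne_zero 3 hd
  constructor
  · intro h
    have h' : d ^ 3 * (4 * x ^ 3 + V.b₂ * x ^ 2 + 2 * V.b₄ * x + V.b₆) = 0 := by linear_combination h
    exact (mul_eq_zero.mp h').resolve_left hd3
  · intro h
    linear_combination d ^ 3 * h

/-- The root set of the twist's `2`-division cubic is `d ·` the root set of the curve's. [cite: SilvermanAEC2009, X.5 Cor. 5.4] -/
theorem setOf_isRoot_twoTorsionPolynomial_quadraticTwist {d : F} (hd : d ≠ 0) :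
    {x : F | (V.quadraticTwist d).twoTorsionPolynomial.toPoly.IsRoot x} =
      (fun x ↦ d * x) '' {x : F | V.twoTorsionPolynomial.toPoly.IsRoot x} := by
  ext y
  simp only [Set.mem_setOf_eq, Set.mem_image]
  constructor
  · intro hy
    refine ⟨d⁻¹ * y, ?_, by rw [mul_inv_cancel_left₀ hd]⟩
    rwa [← isRoot_twoTorsionPolynomial_quadraticTwist_iff V hd, mul_inv_cancel_left₀ hd]
  · rintro ⟨x, hx, rfl⟩
    exact (isRoot_twoTorsionPolynomial_quadraticTwist_iff V hd x).mpr hx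

/-- **`#E^{(d)}(F)[2] = #E(F)[2]` over ANY field `F` with `2 ≠ 0`** (`d ≠ 0`): both are `1 + #{roots of the 2-division cubic}`
(tree `natCard_torsionBy_two_eq`) and the root sets correspond under `x ↦ d x`. Mazur–Rubin's Remark 2.4 `E^F[2] = E[2]` read on
rational points. [cite: MazurRubin2010, Remark 2.4 and Lemma 2.2 (i)] [cite: SilvermanAEC2009, X.5 Cor. 5.4] -/
theorem natCard_torsionBy_two_quadraticTwist [V.IsElliptic] {d : F} (hd : d ≠ 0) :
    haveI := V.isElliptic_quadraticTwist hd
    Nat.card (AddSubgroup.torsionBy (V.quadraticTwist d).toAffine.Point (2 : ℤ)) =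
      Nat.card (AddSubgroup.torsionBy V.toAffine.Point (2 : ℤ)) := by
  haveI := V.isElliptic_quadraticTwist hd
  have h2 : (2 : F) ≠ 0 := two_ne_zero
  rw [natCard_torsionBy_two_eq _ h2, natCard_torsionBy_two_eq _ h2,
    setOf_isRoot_twoTorsionPolynomial_quadraticTwist V hd,
    Set.ncard_image_of_injective _ (mul_right_injective₀ hd)]

omit [NeZero (2 : F)] in
/-- `#{Q : 2 • Q = 0} = #X(F)[2]` (the subtype currency of the Mazur–Rubin named facts vs `AddSubgroup.torsionBy`). [folklore] -/
theorem natCard_twoTorsion_subtype_eq_torsionBy (X : WeierstrassCurve F) :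
    Nat.card {Q : X.toAffine.Point // 2 • Q = 0} = Nat.card (AddSubgroup.torsionBy X.toAffine.Point (2 : ℤ)) := by
  refine Nat.card_congr (Equiv.subtypeEquivRight fun Q => ?_)
  rw [Submodule.mem_toAddSubgroup, Submodule.mem_torsionBy_iff, two_zsmul, two_nsmul]

end Roots

/-! ## §B The twist model over `ℚ_p`: its `2`-torsion is that of `W` -/

section Padic

variable (W : WeierstrassCurve ℚ) [W.IsElliptic]

/-- **Any model `Wd` of `W^{(d)}` has `#Wd(ℚ_p)[2] = #W(ℚ_p)[2]`** (`d ≠ 0`, every prime `p`): base change commutes with the twist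
(`baseChange_quadraticTwist`), a change of variables preserves the point group (`natCard_torsionBy_point_smul`), and §A.
[cite: MazurRubin2010, Remark 2.4 and Lemma 2.2 (i)] -/
theorem natCard_twoTorsion_padic_twist_eq {d : ℚ} (hd : d ≠ 0) {Wd : WeierstrassCurve ℚ} [Wd.IsElliptic]
    {C : VariableChange ℚ} (hWd : C • W.quadraticTwist d = Wd) (p : ℕ) [Fact p.Prime] :
    Nat.card {Q : (Wd.baseChange ℚ_[p]).toAffine.Point // 2 • Q = 0} =
      Nat.card {Q : (W.baseChange ℚ_[p]).toAffine.Point // 2 • Q = 0} := by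
  haveI : (W.baseChange ℚ_[p]).IsElliptic := inferInstanceAs (W.map (algebraMap ℚ ℚ_[p])).IsElliptic
  have hd' : algebraMap ℚ ℚ_[p] d ≠ 0 := (_root_.map_ne_zero _).mpr hd
  rw [natCard_twoTorsion_subtype_eq_torsionBy, natCard_twoTorsion_subtype_eq_torsionBy, ← hWd,
    WeierstrassCurve.baseChange_smul_eq, natCard_torsionBy_point_smul, WeierstrassCurve.baseChange_quadraticTwist,
    natCard_torsionBy_two_quadraticTwist _ hd']

end Padic

/-! ## §C Split primes of `ℚ(√d)`: `d` is a square in `ℚ_v` -/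

section Split

open Literature.NumberTheory.QuadraticFields
open Summit.BirchSwinnertonDyer.BirchSwinnertonDyer.Theorems.GenusKolyTwistingPrime (primesEquiv_eq natCast_not_mem_of_not_dvd)

/-- **`d_F ∈ {d, 4d}` for `F = ℚ(√d)`, `d` square-free `≠ 1`** (Marcus Ch. 2 Thm. 1: `d_F = d` if `d ≡ 1 (mod 4)`, `4d` if
`d ≡ 2, 3 (mod 4)`; tree `Quadratic.discr_eq_of_sq_eq_intCast`, `Quadratic.discr_eq_four_mul_of_sq_eq_intCast`). [cite: Marcus2018, Ch. 2 Thm. 1] -/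
theorem discr_eq_or_eq_four_mul {F : Type*} [Field F] [NumberField F] (h2 : Module.finrank ℚ F = 2)
    {x : F} {d : ℤ} (hx : x ^ 2 = (d : F)) (hsf : Squarefree d) (hd1 : d ≠ 1) :
    NumberField.discr F = d ∨ NumberField.discr F = 4 * d := by
  have h4 := Literature.NumberTheory.EllipticCurves.ModularForms.not_four_dvd_of_squarefree hsf
  have hcases : d % 4 = 1 ∨ (d % 4 = 2 ∨ d % 4 = 3) := by
    rcases Int.emod_emod_of_dvd d (show (4 : ℤ) ∣ 4 from dvd_rfl) with _
    have : d % 4 ≠ 0 := fun h0 ↦ h4 (Int.dvd_of_emod_eq_zero h0)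
    omega
  rcases hcases with h1 | h23
  · exact Or.inl (Quadratic.discr_eq_of_sq_eq_intCast h2 hx h1 hsf hd1)
  · exact Or.inr (Quadratic.discr_eq_four_mul_of_sq_eq_intCast h2 hx h23 hsf)

/-- A totally real number field containing `√d` (`d ≠ 0` an integer) has `d > 0` (square of a real number). [folklore] -/
theorem pos_of_isTotallyReal_of_sq_eq {F : Type*} [Field F] [NumberField F] [IsTotallyReal F]
    {x : F} {d : ℤ} (hx : x ^ 2 = (d : F)) (hd0 : d ≠ 0) : 0 < d := by
  obtain ⟨w⟩ := (inferInstance : Nonempty (InfinitePlace F))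
  have hw : w.IsReal := IsTotallyReal.isReal w
  set σ := InfinitePlace.embedding_of_isReal hw with hσ
  have h1 : (σ x) ^ 2 = (d : ℝ) := by rw [← map_pow, hx, map_intCast]
  have h3 : (0 : ℝ) ≤ d := by rw [← h1]; positivity
  have h4 : (0 : ℤ) ≤ d := by exact_mod_cast h3
  omega

/-- Transport of a `p`-adic square root of an integer along Mathlib's `ℚ_v ≃ ℚ_[p]` (`adicCompletion.padicEquiv`), in the
`algebraMap ℚ ℚ_v` currency of the lineage's place menus. [folklore] -/
theorem exists_sq_eq_adicCompletion_of_isSquare_padic (v : HeightOneSpectrum (𝓞 ℚ)) {d : ℤ}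
    (h : haveI := Fact.mk (primesEquiv v).2; IsSquare ((d : ℤ) : ℚ_[((primesEquiv v : Nat.Primes) : ℕ)])) :
    ∃ s : v.adicCompletion ℚ, s ^ 2 = algebraMap ℚ (v.adicCompletion ℚ) (d : ℚ) := by
  haveI hF : Fact (primesEquiv v : ℕ).Prime := ⟨(primesEquiv v).2⟩
  obtain ⟨r, hr⟩ := h
  set e : v.adicCompletion ℚ ≃+* ℚ_[(primesEquiv v : ℕ)] :=
    RingEquivClass.toRingEquiv (adicCompletion.padicEquiv (R := 𝓞 ℚ) v) with he
  refine ⟨e.symm r, ?_⟩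
  rw [sq, ← map_mul, ← hr, map_intCast, map_intCast]

/-- **A prime that SPLITS in `F = ℚ(√d)` has `d ∈ (ℚ_v^×)²`** (`d` square-free `≠ 1`; every prime, `2` included): `d_F ∈ {d, 4d}`
is a `p`-adic square at a split prime (decomposition law + Hensel, tree `Castella2018.TamagawaQuadratic.isSquare_padic_discr_of_splitsIn`),
and `4` is a square. Mazur–Rubin Lemma 2.10 (i) supplies the SPLIT row of the place menu from this.
[cite: NeukirchANT1999, Ch. I (8.5) Prop.] [cite: MazurRubin2010, Lemma 2.10 (i)] -/
theorem exists_sq_eq_adicCompletion_of_ncard_primesOver_eq_two {F : Type} [Field F] [NumberField F]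
    (h2 : Module.finrank ℚ F = 2) {x : F} {d : ℤ} (hx : x ^ 2 = (d : F)) (hsf : Squarefree d) (hd1 : d ≠ 1)
    (v : HeightOneSpectrum (𝓞 ℚ))
    (hs : ((Ideal.span {(((primesEquiv v : Nat.Primes) : ℕ) : ℤ)}).primesOver (𝓞 F)).ncard = 2) :
    ∃ s : v.adicCompletion ℚ, s ^ 2 = algebraMap ℚ (v.adicCompletion ℚ) (d : ℚ) := by
  haveI hF : Fact (primesEquiv v : ℕ).Prime := ⟨(primesEquiv v).2⟩
  apply exists_sq_eq_adicCompletion_of_isSquare_padic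
  have hD := Castella2018.TamagawaQuadratic.isSquare_padic_discr_of_splitsIn h2 hs
  have hcast : ((NumberField.discr F : ℚ) : ℚ_[((primesEquiv v : Nat.Primes) : ℕ)]) =
      ((NumberField.discr F : ℤ) : ℚ_[((primesEquiv v : Nat.Primes) : ℕ)]) := by push_cast; rfl
  rw [hcast] at hD
  rcases discr_eq_or_eq_four_mul h2 hx hsf hd1 with h | h
  · rwa [h] at hD
  · rw [h] at hD
    obtain ⟨r, hr⟩ := hD
    refine ⟨r / 2, ?_⟩
    push_cast at hr
    linear_combination hr / 4

end Split

/-! ## §D Tamagawa parity at multiplicative places -/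

section Tamagawa

variable {K : Type} [Field K] [NumberField K] (X : WeierstrassCurve K) [X.IsElliptic]

/-- **`c_v` is ODD at a multiplicative place with `ord_v Δ_min` odd** (any number field): split multiplicative ⟹
`c_v = ord_v Δ_min` (tree `localTamagawaNumber_eq_ordMinimalDiscriminant_of_hasSplitMultiplicativeReductionAt`), non-split ⟹
`c_v = 1` for odd `ord_v Δ_min` (tree `localTamagawaNumber_of_hasNonsplitMultiplicativeReductionAt_holds`). This is why Mazur–Rubin's
Lemma 2.10 (iii) is a case of Lemma 2.9. [cite: SilvermanATAEC1994, IV.9.4 Step 2 and Cor. IV.9.2 (d)] [cite: MazurRubin2010, Lemma 2.9, Lemma 2.10 (iii)] -/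
theorem not_two_dvd_localTamagawaNumber_of_mult_of_odd (v : HeightOneSpectrum (𝓞 K))
    (hmult : X.HasMultiplicativeReductionAt v) (hodd : Odd (X.ordMinimalDiscriminant v)) :
    ¬ 2 ∣ (X.baseChange (v.adicCompletion K)).localTamagawaNumber (v.adicCompletionIntegers K) := by
  haveI : Finite (IsLocalRing.ResidueField (v.adicCompletionIntegers K)) :=
    IsDedekindDomain.HeightOneSpectrum.finite_residueField_adicCompletionIntegers K v
  by_cases hs : X.HasSplitMultiplicativeReductionAt v
  · rw [localTamagawaNumber_eq_ordMinimalDiscriminant_of_hasSplitMultiplicativeReductionAt v X hs]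
    exact hodd.not_two_dvd_nat
  · rw [localTamagawaNumber_of_hasNonsplitMultiplicativeReductionAt_holds v X hmult hs,
      if_neg (Nat.not_even_iff_odd.mpr hodd)]
    decide

end Tamagawa

/-! ## §E `ord_v(Δ_min) ≡ ord_p(Δ(W)) (mod 12)` at the places of `𝓞 ℚ` -/

section Parity

variable (W : WeierstrassCurve ℚ) [W.IsElliptic]

/-- **`ord_v(Δ_min) ≡ ord_p(Δ(W)) (mod 12)` at the places of `𝓞 ℚ`, parity form**, for ANY model `W` of an elliptic curve over `ℚ`
(tree `twelve_dvd_ordMinimalDiscriminant_sub_padicValRat_Δ` at the places of `ℤ`, transported through the `R`-independent `p`-adic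
description `ordMinimalDiscriminant_eq_padic`). [cite: SilvermanAEC2009, VII.1 Remark 1.1 and Prop. 1.3] -/
theorem odd_ordMinimalDiscriminant_iff_odd_padicValRat (v : HeightOneSpectrum (𝓞 ℚ)) :
    Odd (W.ordMinimalDiscriminant v) ↔ Odd (padicValRat ((primesEquiv v : Nat.Primes) : ℕ) W.Δ) := by
  set v' : HeightOneSpectrum ℤ := (primesEquiv (R := ℤ)).symm (primesEquiv v) with hv'
  have hvv' : primesEquiv v' = primesEquiv v := by rw [hv', Equiv.apply_symm_apply]
  have htrans : W.ordMinimalDiscriminant v = W.ordMinimalDiscriminant v' := by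
    rw [W.ordMinimalDiscriminant_eq_padic v, W.ordMinimalDiscriminant_eq_padic v', hvv']
  have hgen : natGenerator v' = ((primesEquiv v : Nat.Primes) : ℕ) := by
    change (primesEquiv v' : ℕ) = (primesEquiv v : ℕ)
    rw [hvv']
  have h12 := W.twelve_dvd_ordMinimalDiscriminant_sub_padicValRat_Δ v'
  rw [hgen, ← htrans] at h12
  obtain ⟨k, hk⟩ := h12
  have hrel : (W.ordMinimalDiscriminant v : ℤ) = padicValRat ((primesEquiv v : Nat.Primes) : ℕ) W.Δ + 12 * k := by
    linear_combination hk
  constructor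
  · rintro ⟨m, hm⟩
    refine ⟨(m : ℤ) - 6 * k, ?_⟩
    have : (W.ordMinimalDiscriminant v : ℤ) = 2 * m + 1 := by exact_mod_cast hm
    linear_combination -hrel + this
  · rintro ⟨m, hm⟩
    have h0 : (0 : ℤ) ≤ W.ordMinimalDiscriminant v := by positivity
    have hint : (W.ordMinimalDiscriminant v : ℤ) = 2 * (m + 6 * k) + 1 := by rw [hrel, hm]; ring
    refine ⟨(m + 6 * k).toNat, ?_⟩
    have hnn : 0 ≤ m + 6 * k := by omega
    zify
    rw [Int.toNat_of_nonneg hnn]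
    exact hint

end Parity

/-! ## §F The twist at odd unramified places (via a global minimal model) and the silent row -/

section TwistRows

open Summit.BirchSwinnertonDyer.Rank1Residual.AdditivePotMult
open Summit.BirchSwinnertonDyer.BirchSwinnertonDyer.Theorems.GenusKolyTwistingPrime (primesEquiv_eq natCast_not_mem_of_not_dvd)

variable (W : WeierstrassCurve ℚ) [W.IsElliptic]

/-- **Lemma 2.10 (v), reduction side: at an odd `p ∤ d` of good reduction the twist `W^{(d)}` has good reduction** — ANY model `W`
(the tree's `AdditivePotMult.hasGoodReductionAt_quadraticTwist_of_not_dvd` on a global minimal model `C • W`, `hasGlobalMinimalModel_rat_holds`,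
transported by `quadraticTwist_smul` and `hasGoodReductionAt_smul_iff_holds`). [cite: SilvermanAEC2009, VII.5 Prop. 5.1 (a)] [cite: MazurRubin2010, Lemma 2.10 (v)] -/
theorem hasGoodReductionAt_quadraticTwist_of_not_dvd_any (v : HeightOneSpectrum (𝓞 ℚ))
    (hv2 : ((primesEquiv v : Nat.Primes) : ℕ) ≠ 2) {d : ℤ} (hd : ¬ (((primesEquiv v : Nat.Primes) : ℕ) : ℤ) ∣ d)
    (hgood : W.HasGoodReductionAt v) : (W.quadraticTwist (d : ℚ)).HasGoodReductionAt v := by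
  obtain ⟨C, hC⟩ := hasGlobalMinimalModel_rat_holds W
  haveI := hC
  have hg0 : (C • W).HasGoodReductionAt v := (hasGoodReductionAt_smul_iff_holds v W C).mpr hgood
  have h := (hasGoodReductionAt_quadraticTwist_of_not_dvd (C • W) v hv2 hd hg0).2
  rw [quadraticTwist_smul W C (d : ℚ)] at h
  exact (hasGoodReductionAt_smul_iff_holds v _ _).mp h

/-- **Lemma 2.10 (iii), reduction side: at an odd `p ∤ d` of multiplicative reduction the twist `W^{(d)}` is multiplicative** — ANY
model `W` (`AdditivePotMult.hasMultiplicativeReductionAt_and_split_iff_quadraticTwist_of_not_dvd` on a global minimal model, transported).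
[cite: SilvermanAEC2009, VII.5 Prop. 5.1 (b)] [cite: MazurRubin2010, Lemma 2.10 (iii)] -/
theorem hasMultiplicativeReductionAt_quadraticTwist_of_not_dvd_any (v : HeightOneSpectrum (𝓞 ℚ))
    (hv2 : ((primesEquiv v : Nat.Primes) : ℕ) ≠ 2) {d : ℤ} (hd : ¬ (((primesEquiv v : Nat.Primes) : ℕ) : ℤ) ∣ d)
    (hmult : W.HasMultiplicativeReductionAt v) : (W.quadraticTwist (d : ℚ)).HasMultiplicativeReductionAt v := by
  have hd0 : (d : ℚ) ≠ 0 := by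
    have : d ≠ 0 := fun h ↦ hd (h ▸ dvd_zero _)
    exact_mod_cast this
  obtain ⟨C, hC⟩ := hasGlobalMinimalModel_rat_holds W
  haveI := hC
  haveI := W.isElliptic_quadraticTwist hd0
  have hm0 : (C • W).HasMultiplicativeReductionAt v := (hasMultiplicativeReductionAt_smul_iff_holds v W C).mpr hmult
  have h := (hasMultiplicativeReductionAt_and_split_iff_quadraticTwist_of_not_dvd (C • W) v hv2 hd hm0).1
  rw [quadraticTwist_smul W C (d : ℚ)] at h
  exact (hasMultiplicativeReductionAt_smul_iff_holds v _ _).mp h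

/-- `ord_p Δ(W^{(d)}) = 6 ord_p d + ord_p Δ(W)` (`Δ(W^{(d)}) = d⁶ Δ(W)`), so for `p ∤ d` the parities agree. [cite: SilvermanAEC2009, X.5 Cor. 5.4] -/
theorem odd_padicValRat_Δ_quadraticTwist_iff {p : ℕ} [Fact p.Prime] {d : ℤ} (hd : ¬ (p : ℤ) ∣ d) :
    Odd (padicValRat p (W.quadraticTwist (d : ℚ)).Δ) ↔ Odd (padicValRat p W.Δ) := by
  have hd0 : d ≠ 0 := fun h ↦ hd (h ▸ dvd_zero _)
  have hdQ : (d : ℚ) ≠ 0 := by exact_mod_cast hd0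
  have hΔ : W.Δ ≠ 0 := W.isUnit_Δ.ne_zero
  have hvd : padicValRat p (d : ℚ) = 0 := by
    rw [padicValRat.of_int, Int.natCast_eq_zero]  -- padicValRat p ↑d = ↑(padicValInt p d)
    exact padicValInt.eq_zero_of_not_dvd hd
  rw [quadraticTwist_Δ, padicValRat.mul (pow_ne_zero 6 hdQ) hΔ, padicValRat.pow (d : ℚ), hvd, mul_zero, zero_add]

omit [W.IsElliptic] in
/-- From «`W(ℚ_p)` has no point of order `2`» (the `T`-clause currency of the Mazur–Rubin named facts, Mathlib's `ℚ_[p]`) to the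
SILENT-row currency `#ker(2 : W(ℚ_v) → W(ℚ_v)) = 1` of the place menus (`natCard_ker_nsmul_adicCompletion_eq_padic`). [folklore] -/
theorem natCard_ker_nsmul_two_adicCompletion_eq_one_of_forall (v : HeightOneSpectrum (𝓞 ℚ))
    (h : haveI := Fact.mk (primesEquiv v).2
      ∀ Q : (W.baseChange ℚ_[((primesEquiv v : Nat.Primes) : ℕ)]).toAffine.Point, 2 • Q = 0 → Q = 0) :
    Nat.card (nsmulAddMonoidHom 2 : (W.baseChange (v.adicCompletion ℚ)).toAffine.Point →+ _).ker = 1 := by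
  haveI := Fact.mk (primesEquiv v).2
  rw [GenusKolyTwistLocal.natCard_ker_nsmul_adicCompletion_eq_padic W v 2]
  haveI : Unique {Q : (W.baseChange ℚ_[((primesEquiv v : Nat.Primes) : ℕ)]).toAffine.Point // 2 • Q = 0} :=
    { default := ⟨0, by simp⟩
      uniq := fun Q ↦ Subtype.ext (h Q.1 Q.2) }
  exact Nat.card_unique

end TwistRows

end Summit.BirchSwinnertonDyer.BirchSwinnertonDyer.Theorems.GenusKolyTwistTamagawa

end
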